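import Summits.QuantumFields.YangMills.Theorems.UnitScaleTiltCoverPullback
import Summits.QuantumFields.YangMills.Theorems.UnitScaleTiltCoverDomains
import HarnessLib

/-!
# Route `UnitScaleTilt`, crux K1 child «MinimiserStabilityRegPr» (stmt-QuantumFields-19200), registered stub `stub_halvingStep` (H), branch (P2-small),
# mechanism of record **(α) COVERING ∕ PERIODISATION** (OWNER RULING g26-№18) — brick (B) = α3c `CoverGaugeFix`: **THE GAUGE-FIXING PROJECTION `R` ONTO `ΔN(Q′)` OF
# [Balaban1984PropagatorsII] (2.10)–(2.12) INTERTWINES WITH THE SITE PULLBACK ALONG THE COVERING MAP, HENCE SO DOES THE SUMMAND `∂R∂*` OF `Δ_a` (2.19)** —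
# modulo the two multi-scale site-average identities (`Q′_j` with pullback ∕ with fibre sums), displayed as hypotheses and discharged in file (C) from LEAD's
# generic `…CoverAverages`

Cell `ym3-torus` (HUMAN RULING D-0037, YM ladder rung R3 — continuum SU(2) YM₃ on the torus is a RUNG, not the Clay problem), width seat `ym-ust-20520-w1` gen 5,
following LEAD `ym-ust-19200-w5` g3's FINAL HANDOFF § (cell HANDOFF.md) by name.  `--supports stmt-QuantumFields-19200 --as helper`; def-free, 0 sorry, standard axioms.

THE POINT ([Balaban1984PropagatorsII] p. 225: *«R — an orthogonal projection in the space L²(T_η) onto the subspace ΔN(Q′)»*, `N(Q′) = {λ : λ = 0 on Λ₀, Q′_jλ = 0 on Λ_j}`).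
An orthogonal projection commutes with a map `πS` as soon as `πS(K) ⊆ K̃` and `πS(Kᗮ) ⊆ K̃ᗮ` (✓`CoverFlatOps.starProjection_intertwine_of_push`, the second inclusion
supplied by the adjoint = fibre sum `πS†` with `πS†(K̃) ⊆ K`).  For `K = ΔN(Q′)`: `πS(Δλ) = Δ(πSλ)` (✓`CoverPullback.lapE_pull`) with `πSλ ∈ N(Q̃′)` because
`Λ̃_j = proj⁻¹Λ_j` (✓`CoverDomains.lamSite_comap_iff`) and `Q′_j(λ∘proj) = (Q′_jλ)∘proj` (hypothesis `hpull`); `πS†(Δλ̃) = Δ(πS†λ̃)` (✓`lapE_push`) with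
`πS†λ̃ ∈ N(Q′)` because `Q′_j(fibre sum) = fibre sum of Q′_j` (hypothesis `hpush`) and every lift of a `Λ_j`-site is a `Λ̃_j`-site.
* §1 `inGauge_pull`, `inGauge_push` (the kernels `N(Q′)` under `πS`, `πS†`), `KE_pull`, `KE_push` (the subspaces `ΔN(Q′)`).
* §2 ★`RE_pull : RE (D.comap jc) c (πS s) = πS (RE D c s)`; ★`h2_pull : (∂ ∘ R̃ ∘ ∂*)(πB u) = πB ((∂ ∘ R ∘ ∂*) u)` — the second hypothesis of
  ✓`CoverFlatOps.deltaAE_intertwine_of_summands` at the cover (✓`CoverPullback.h2_pull_of`).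
HYPOTHESES (displayed; both are [Balaban1984PropagatorsI] (1.20) read through the covering map, LEAD's `…CoverAverages` at `φ i := proj P jc i`):
`hpull : ∀ f j, j ≤ m+K → ∀ yt, siteAvgIter j (f ∘ proj P jc 0) yt = siteAvgIter j f (proj P jc j yt)`;
`hpush : ∀ g j, j ≤ m+K → ∀ y, siteAvgIter j (x ↦ Σ_{xt : proj xt = x} g xt) y = Σ_{yt : proj yt = y} siteAvgIter j g yt`.
HONEST SCOPE: linear bookkeeping; NOT a claim about the H stub, the crux, the rung or a mass gap.

References: T. Bałaban, CMP **96** (1984) 223–250 [Balaban1984PropagatorsII] (2.7)–(2.12) pp.224–225, (2.19) p.226; CMP **95** (1984) 17–40 [Balaban1984PropagatorsI] (1.20) p.20.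
-/

set_option autoImplicit false

noncomputable section

open scoped BigOperators InnerProductSpace

namespace Summit.QuantumFields.YangMills.Theorems.CoverGaugeFix

open Literature.MathematicalPhysics.QuantumFieldTheory.Balaban1983to89
open LatticeFieldCalculus (siteAvgIter)
open B6SectADomainsV1 (Domains)
open B6SectAOperatorsV1 (onE ScalarSpace dE dsE lapE QpE KE RE mem_ker_QpE_iff)
open Literature.MathematicalPhysics.QuantumFieldTheory.BalabanImbrieJaffe1984to88.BIJ85AxialPropagator411 (BondSpace)
open CoverSites (cover proj projBond)
open CoverDomains (lamSite_comap_iff)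
open CoverPullback (onE_funLeft_apply adjoint_onE_funLeft_apply ofLp_adjoint_onE_funLeft inner_onE_funLeft_left lapE_pull lapE_push h2_pull_of)
open CoverFlatOps (starProjection_intertwine_of_push)

variable {P : Params} (D : Domains P) (jc : ℕ) (c : ℝ)

/-! ## §1 `N(Q′)` and `ΔN(Q′)` under the site pullback and its adjoint -/

/-- **`λ ∈ N(Q′) ⇒ λ∘proj ∈ N(Q̃′)`** (territories are preimages; `Q′_j` commutes with the pullback — hypothesis `hpull`).
[cite: Balaban1984PropagatorsII, (2.7) p.224, (2.10) p.225] -/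
theorem inGauge_pull
    (hpull : ∀ (f : SiteField P 0 ℝ) (j : ℕ), j ≤ P.m + P.K → ∀ yt : Site (cover P jc) j,
      siteAvgIter j (f ∘ proj P jc 0) yt = siteAvgIter j f (proj P jc j yt))
    {lam : SiteField P 0 ℝ} (h : D.InGauge lam) : (D.comap jc).InGauge (lam ∘ proj P jc 0) := by
  intro j yt hyt
  rw [lamSite_comap_iff] at hyt
  rw [hpull lam j (le_trans ((D.comap jc).le_of_lamSite ((lamSite_comap_iff D jc j yt).2 hyt)) D.hk) yt]
  exact h j _ hyt

/-- **`λ̃ ∈ N(Q̃′) ⇒ (fibre sum of λ̃) ∈ N(Q′)`** (every lift of a `Λ_j`-site is a `Λ̃_j`-site; `Q′_j` commutes with fibre sums — hypothesis `hpush`).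
[cite: Balaban1984PropagatorsII, (2.7) p.224, (2.10) p.225] -/
theorem inGauge_push
    (hpush : ∀ (g : SiteField (cover P jc) 0 ℝ) (j : ℕ), j ≤ P.m + P.K → ∀ y : Site P j,
      siteAvgIter j (fun x => ∑ xt : {xt : Site (cover P jc) 0 // proj P jc 0 xt = x}, g xt.1) y =
        ∑ yt : {yt : Site (cover P jc) j // proj P jc j yt = y}, siteAvgIter j g yt.1)
    {lam : SiteField (cover P jc) 0 ℝ} (h : (D.comap jc).InGauge lam) :
    D.InGauge (fun x => ∑ xt : {xt : Site (cover P jc) 0 // proj P jc 0 xt = x}, lam xt.1) := by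
  intro j y hy
  rw [hpush lam j (le_trans (D.le_of_lamSite hy) D.hk) y]
  refine Finset.sum_eq_zero fun yt _ => h j yt.1 ?_
  rw [lamSite_comap_iff, yt.2]
  exact hy

/-- the site pullback of `f`, as a function, is `f ∘ proj`. [cite: Balaban1984PropagatorsII, (2.8) p.224] -/
theorem ofLp_pullS (f : ScalarSpace P) : WithLp.ofLp (onE (LinearMap.funLeft ℝ ℝ (proj P jc 0)) f) = WithLp.ofLp f ∘ proj P jc 0 := rfl

/-- **`ΔN(Q′)` IS MAPPED INTO `ΔÑ(Q̃′)` BY THE PULLBACK**. [cite: Balaban1984PropagatorsII, (2.10) p.225] -/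
theorem KE_pull
    (hpull : ∀ (f : SiteField P 0 ℝ) (j : ℕ), j ≤ P.m + P.K → ∀ yt : Site (cover P jc) j,
      siteAvgIter j (f ∘ proj P jc 0) yt = siteAvgIter j f (proj P jc j yt))
    {k : ScalarSpace P} (hk : k ∈ KE D c) : onE (LinearMap.funLeft ℝ ℝ (proj P jc 0)) k ∈ KE (D.comap jc) c := by
  obtain ⟨s, hs, rfl⟩ := Submodule.mem_map.1 hk
  refine Submodule.mem_map.2 ⟨onE (LinearMap.funLeft ℝ ℝ (proj P jc 0)) s, ?_, lapE_pull P jc c s⟩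
  rw [mem_ker_QpE_iff] at hs ⊢
  rw [ofLp_pullS]
  exact inGauge_pull D jc hpull hs

/-- **`ΔÑ(Q̃′)` IS MAPPED INTO `ΔN(Q′)` BY THE FIBRE SUM** `πS†`. [cite: Balaban1984PropagatorsII, (2.10) p.225] -/
theorem KE_push
    (hpush : ∀ (g : SiteField (cover P jc) 0 ℝ) (j : ℕ), j ≤ P.m + P.K → ∀ y : Site P j,
      siteAvgIter j (fun x => ∑ xt : {xt : Site (cover P jc) 0 // proj P jc 0 xt = x}, g xt.1) y =
        ∑ yt : {yt : Site (cover P jc) j // proj P jc j yt = y}, siteAvgIter j g yt.1)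
    {kt : ScalarSpace (cover P jc)} (hkt : kt ∈ KE (D.comap jc) c) :
    LinearMap.adjoint (onE (LinearMap.funLeft ℝ ℝ (proj P jc 0))) kt ∈ KE D c := by
  classical
  obtain ⟨st, hst, rfl⟩ := Submodule.mem_map.1 hkt
  refine Submodule.mem_map.2 ⟨LinearMap.adjoint (onE (LinearMap.funLeft ℝ ℝ (proj P jc 0))) st, ?_, lapE_push P jc c st⟩
  rw [mem_ker_QpE_iff] at hst ⊢
  rw [ofLp_adjoint_onE_funLeft]
  exact inGauge_push D jc hpush hst

/-! ## §2 `R` and `∂R∂*` intertwine with the pullbacks -/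

/-- ★ **`R` INTERTWINES WITH THE SITE PULLBACK**: `R̃ (πS s) = πS (R s)` — orthogonal projections onto `ΔN(Q′)` ∕ `ΔÑ(Q̃′)`; ✓`starProjection_intertwine_of_push` with
`KE_pull` and `KE_push`. [cite: Balaban1984PropagatorsII, (2.10)-(2.12) p.225] -/
theorem RE_pull
    (hpull : ∀ (f : SiteField P 0 ℝ) (j : ℕ), j ≤ P.m + P.K → ∀ yt : Site (cover P jc) j,
      siteAvgIter j (f ∘ proj P jc 0) yt = siteAvgIter j f (proj P jc j yt))
    (hpush : ∀ (g : SiteField (cover P jc) 0 ℝ) (j : ℕ), j ≤ P.m + P.K → ∀ y : Site P j,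
      siteAvgIter j (fun x => ∑ xt : {xt : Site (cover P jc) 0 // proj P jc 0 xt = x}, g xt.1) y =
        ∑ yt : {yt : Site (cover P jc) j // proj P jc j yt = y}, siteAvgIter j g yt.1)
    (s : ScalarSpace P) :
    RE (D.comap jc) c (onE (LinearMap.funLeft ℝ ℝ (proj P jc 0)) s) = onE (LinearMap.funLeft ℝ ℝ (proj P jc 0)) (RE D c s) := by
  rw [B6SectAOperatorsV1.RE_apply, B6SectAOperatorsV1.RE_apply]
  exact starProjection_intertwine_of_push (KE D c) (KE (D.comap jc) c) (onE (LinearMap.funLeft ℝ ℝ (proj P jc 0)))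
    (LinearMap.adjoint (onE (LinearMap.funLeft ℝ ℝ (proj P jc 0)))) (inner_onE_funLeft_left _)
    (fun k hk => KE_pull D jc c hpull hk) (fun kt hkt => KE_push D jc c hpush hkt) s

/-- ★ **`h2`: `∂R∂*` INTERTWINES WITH THE BOND PULLBACK** — the second hypothesis of ✓`CoverFlatOps.deltaAE_intertwine_of_summands` at the cover.
[cite: Balaban1984PropagatorsII, (2.19) p.226] -/
theorem h2_pull
    (hpull : ∀ (f : SiteField P 0 ℝ) (j : ℕ), j ≤ P.m + P.K → ∀ yt : Site (cover P jc) j,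
      siteAvgIter j (f ∘ proj P jc 0) yt = siteAvgIter j f (proj P jc j yt))
    (hpush : ∀ (g : SiteField (cover P jc) 0 ℝ) (j : ℕ), j ≤ P.m + P.K → ∀ y : Site P j,
      siteAvgIter j (fun x => ∑ xt : {xt : Site (cover P jc) 0 // proj P jc 0 xt = x}, g xt.1) y =
        ∑ yt : {yt : Site (cover P jc) j // proj P jc j yt = y}, siteAvgIter j g yt.1)
    (u : BondSpace P) :
    (dE c ∘ₗ RE (D.comap jc) c ∘ₗ dsE c) (onE (LinearMap.funLeft ℝ ℝ (projBond P jc 0)) u) =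
      onE (LinearMap.funLeft ℝ ℝ (projBond P jc 0)) ((dE c ∘ₗ RE D c ∘ₗ dsE c) u) :=
  h2_pull_of P jc c (RE D c) (RE (D.comap jc) c) (RE_pull D jc c hpull hpush) u

end Summit.QuantumFields.YangMills.Theorems.CoverGaugeFix

end
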